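import Summits.QuantumAdvantage.QuantumAdvantage.Theorems.SosSandwichPseudoBoundedAAClassicalCornerQueryOSSS
import Summits.QuantumAdvantage.QuantumAdvantage.Theorems.SosSandwichPseudoBoundedAABooleanCorner
import HarnessLib

/-!
# Crux `PseudoBoundedAA` (stmt-QuantumAdvantage-15237, route SosSandwich) — the SENSITIVITY form of the `L²`-OSSS law on
# the classical corner, part 1/3: elementary lemmas

Support file (`--supports stmt-QuantumAdvantage-15237`).  The hands' census for this crux isolates ONE inequality on the
classical corner `R_T ⊆ K_T` (acceptance probabilities `p = Σ_k w_k·[t_k accepts]` of randomized decision trees): the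
conjectured `L²`-OSSS law `16·Var[p]² ≤ C₀·Σⱼ δ̄ⱼ·Infⱼ[p]` (`δ̄ⱼ = Σ_k w_k·Pr_x[j ∈ t_k.queries x]`), which would give the
sharp `(2,1)` exponent shape on `R_T` (`…ClassicalCornerExponentsL2OSSS.lean`); the tree has it with an extra factor `Σⱼ δ̄ⱼ`
(`ClassicalCornerQueryOSSS.sixteen_variance_sq_le_sum_queryProb_mul`) or `D̄`.  This three-file series
(`…SensitivityOSSSPrep`, `…SensitivityOSSSAux`, `…SensitivityOSSS`) proves it with that factor replaced by the AVERAGE TOTAL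
INFLUENCE (average sensitivity) `Ī = Σ_k w_k·I[t_k]` of the constituent Boolean trees,
`I[t] = Σⱼ Pr_x[t(x^{j→1}) ≠ t(x^{j→0})] ≤ Σⱼ δⱼ(t) ≤ depth(t)`:

  `16·Var[p]² ≤ (Σ_k w_k·I[t_k]) · (Σⱼ δ̄ⱼ·Infⱼ[p])`   (`sixteen_variance_sq_le_avgSensitivity_mul`, part 3).

This part: the parameter-AM–GM step (`mul_le_of_pos`), its optimisation (`sixteen_sq_le_of_forall_pos`:
`(∀ λ>0, v ≤ (λa + b/λ)/8) ⟹ 16v² ≤ ab`), the squared analogue `sum_sq_sections_le` of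
`BooleanCorner.sum_abs_sections_le` (squared increments of the average of the two `i`-sections of `g`), and the
identifications `Σₓ (F(x^{j→1}) − F(x^{j→0}))² = #pivotal points` (`sum_sq_update_eq_card`), pivotal ⟹ queried
(`card_pivotal_le_card_queries`, `avgSensitivity_le_sum_queryProb`: `Ī ≤ Σⱼ δ̄ⱼ`, so part 3 refines the tree's law);
`Σₓ (p(x^{j→1}) − p(x^{j→0}))² = 2^N·Infⱼ[p]` is the tree's `BooleanCorner.sum_sq_update_eq_influence`.

Honest label: elementary lemmas for a corner calibration of an open conjecture; no registered stub, crux or summit is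
closed.  Sources: R. O'Donnell, M. Saks, O. Schramm, R. Servedio, FOCS 2005, Thm 3.2; H. Buhrman, R. de Wolf, *Complexity
measures and decision tree complexity*, TCS 288 (2002) §2.1; R. O'Donnell, *Analysis of Boolean Functions* (2014) §8.6.
-/

set_option linter.dupNamespace false

noncomputable section

namespace Summit.QuantumAdvantage.QuantumAdvantage.Theorems.SosSandwich

open Finset Function
open Literature.Computability.Complexity Literature.Computability.QuantumComplexity

namespace ClassicalCornerSensitivityOSSS

variable {N : ℕ}

/-! ### Two elementary inequalities -/

/-- AM–GM with a free parameter: `ab ≤ (λ/2)a² + b²/(2λ)` for `λ > 0`. [folklore] -/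
theorem mul_le_of_pos {lam : ℝ} (hl : 0 < lam) (a b : ℝ) : a * b ≤ lam / 2 * a ^ 2 + b ^ 2 / (2 * lam) := by
  have h : lam / 2 * a ^ 2 + b ^ 2 / (2 * lam) - a * b = (lam * a - b) ^ 2 / (2 * lam) := by
    field_simp
    ring
  have h2 : 0 ≤ (lam * a - b) ^ 2 / (2 * lam) := div_nonneg (sq_nonneg _) (by positivity)
  rw [← h] at h2
  linarith

/-- Optimising the free parameter: if `v ≤ (λa + b/λ)/8` for every `λ > 0` (`v, a, b ≥ 0`) then `16 v² ≤ a·b`.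
[folklore] -/
theorem sixteen_sq_le_of_forall_pos {v a b : ℝ} (hv : 0 ≤ v) (ha : 0 ≤ a) (hb : 0 ≤ b)
    (h : ∀ lam : ℝ, 0 < lam → v ≤ (lam * a + b / lam) / 8) : 16 * v ^ 2 ≤ a * b := by
  rcases hv.eq_or_lt with hv0 | hvpos
  · rw [← hv0]; nlinarith
  rcases ha.eq_or_lt with ha0 | hapos
  · -- `a = 0`: `v ≤ b/(8λ)` for all `λ`, so `v ≤ 0`
    exfalso
    rcases hb.eq_or_lt with hb0 | hbpos
    · have := h 1 one_pos
      rw [← ha0, ← hb0] at this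
      linarith
    · have hl : 0 < b / (4 * v) := div_pos hbpos (by linarith)
      have := h (b / (4 * v)) hl
      rw [← ha0, mul_zero, zero_add] at this
      have hcalc : b / (b / (4 * v)) / 8 = v / 2 := by
        field_simp
        ring
      rw [hcalc] at this
      linarith
  · -- `a > 0`: take `λ = 4v/a`
    have hl : 0 < 4 * v / a := div_pos (by linarith) hapos
    have := h (4 * v / a) hl
    have hcalc : (4 * v / a * a + b / (4 * v / a)) / 8 = v / 2 + a * b / (32 * v) := by
      field_simp
      ring
    rw [hcalc] at this
    have h32 : 0 < 32 * v := by linarith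
    have : v / 2 ≤ a * b / (32 * v) := by linarith
    rw [le_div_iff₀ h32] at this
    nlinarith

/-! ### Squared increments of the average of two sections -/

/-- The squared increments of the average `Γ = (g(x^{i→0}) + g(x^{i→1}))/2` of the two `i`-sections of `g` are dominated by
those of `g`: `Σₓ (Γ(x^{j→1}) − Γ(x^{j→0}))² ≤ Σₓ (g(x^{j→1}) − g(x^{j→0}))²` (for `j = i` the left side vanishes;
for `j ≠ i`, `((a+b)/2)² ≤ (a²+b²)/2`). [folklore] -/
theorem sum_sq_sections_le (i j : Fin N) (g : (Fin N → Bool) → ℝ) :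
    ∑ x, ((g (update (update x j true) i false) + g (update (update x j true) i true)) / 2
        - (g (update (update x j false) i false) + g (update (update x j false) i true)) / 2) ^ 2
      ≤ ∑ x, (g (update x j true) - g (update x j false)) ^ 2 := by
  by_cases hji : j = i
  · subst hji
    have h0 : ∀ x : Fin N → Bool,
        ((g (update (update x j true) j false) + g (update (update x j true) j true)) / 2
          - (g (update (update x j false) j false) + g (update (update x j false) j true)) / 2) ^ 2 = 0 := by
      intro x; simp
    rw [Finset.sum_congr rfl fun x _ => h0 x, Finset.sum_const_zero]
    exact Finset.sum_nonneg fun x _ => sq_nonneg _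
  have hcomm : ∀ (x : Fin N → Bool) (c b : Bool), update (update x j c) i b = update (update x i b) j c :=
    fun x c b => update_comm hji _ _ _
  set h : (Fin N → Bool) → ℝ := fun y => (g (update y j true) - g (update y j false)) ^ 2 with hh
  have hsplit := BooleanCorner.sum_eq_half_sum_update i h
  have hpt : ∀ x : Fin N → Bool,
      ((g (update (update x j true) i false) + g (update (update x j true) i true)) / 2
        - (g (update (update x j false) i false) + g (update (update x j false) i true)) / 2) ^ 2
        ≤ (h (update x i true) + h (update x i false)) / 2 := by
    intro x
    simp only [hh, hcomm]
    nlinarith [sq_nonneg ((g (update (update x i true) j true) - g (update (update x i true) j false))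
      - (g (update (update x i false) j true) - g (update (update x i false) j false)))]
  calc _ ≤ ∑ x, (h (update x i true) + h (update x i false)) / 2 := Finset.sum_le_sum fun x _ => hpt x
    _ = ((∑ x, h (update x i true)) + ∑ x, h (update x i false)) / 2 := by
        rw [← Finset.sum_div, Finset.sum_add_distrib]
    _ = ∑ x, h x := hsplit.symm
    _ = _ := by simp only [hh]

/-! ### Pivotal points, queries, influences -/

/-- The squared increments of a tree's `0/1` output count the pivotal points:
`Σₓ (F(x^{j→1}) − F(x^{j→0}))² = #{x : t.eval(x^{j→1}) ≠ t.eval(x^{j→0})}`. [folklore] -/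
theorem sum_sq_update_eq_card (t : DecisionTree N) (F : (Fin N → Bool) → ℝ)
    (hF : ∀ x, F x = if t.eval x = true then (1 : ℝ) else 0) (j : Fin N) :
    ∑ x, (F (update x j true) - F (update x j false)) ^ 2 =
      ((Finset.univ.filter fun x : Fin N → Bool => t.eval (update x j true) ≠ t.eval (update x j false)).card : ℝ) := by
  classical
  rw [← Finset.sum_boole]
  refine Finset.sum_congr rfl fun x _ => ?_
  rw [hF, hF]
  cases t.eval (update x j true) <;> cases t.eval (update x j false) <;> simp

/-- **Pivotal coordinates are queried:** `#{x : t.eval(x^{j→1}) ≠ t.eval(x^{j→0})} ≤ #{x : j ∈ t.queries x}`, hence the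
total influence of a tree is at most its expected number of (distinct) queries, `I[t] ≤ Σⱼ δⱼ(t) ≤ depth(t)`.
[cite: Wolf2002, §2.1] -/
theorem card_pivotal_le_card_queries (t : DecisionTree N) (j : Fin N) :
    (Finset.univ.filter fun x : Fin N → Bool => t.eval (update x j true) ≠ t.eval (update x j false)).card ≤
      (Finset.univ.filter fun x : Fin N → Bool => j ∈ t.queries x).card := by
  classical
  refine Finset.card_le_card fun x hx => ?_
  rw [Finset.mem_filter] at hx ⊢
  refine ⟨hx.1, ?_⟩
  by_contra hj
  apply hx.2
  rw [DecisionTree.eval_update_of_not_mem_queries t x hj, DecisionTree.eval_update_of_not_mem_queries t x hj]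

/-- The average total influence of a mixture is at most its expected number of queries: `Σ_k w_k·I[t_k] ≤ Σⱼ δ̄ⱼ`
(so the sensitivity law below refines `ClassicalCornerQueryOSSS.sixteen_variance_sq_le_sum_queryProb_mul`).
[cite: Wolf2002, §2.1] -/
theorem avgSensitivity_le_sum_queryProb {ι : Type*} (s : Finset ι) (w : ι → ℝ) (hw : ∀ k ∈ s, 0 ≤ w k)
    (t : ι → DecisionTree N) :
    (∑ k ∈ s, w k * ∑ j, (((Finset.univ.filter fun x : Fin N → Bool =>
        (t k).eval (update x j true) ≠ (t k).eval (update x j false)).card : ℝ) / (2 : ℝ) ^ N)) ≤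
      ∑ j, ∑ k ∈ s, w k *
        (((Finset.univ.filter fun x : Fin N → Bool => j ∈ (t k).queries x).card : ℝ) / (2 : ℝ) ^ N) := by
  rw [Finset.sum_comm]
  refine Finset.sum_le_sum fun k hk => ?_
  rw [← Finset.mul_sum]
  refine mul_le_mul_of_nonneg_left (Finset.sum_le_sum fun j _ => ?_) (hw k hk)
  refine div_le_div_of_nonneg_right ?_ (by positivity)
  exact_mod_cast card_pivotal_le_card_queries (t k) j

end ClassicalCornerSensitivityOSSS

end Summit.QuantumAdvantage.QuantumAdvantage.Theorems.SosSandwich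

end
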